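import Literature.AlgebraicGeometry.HodgeTheory.CyclicCoverNodalMeridianLocalMonodromy
import HarnessLib

/-!
# The `τ`-FREE local monodromy of a meridian of the cyclic family centred at a one-nodal branch curve, BOUND FORM:
# a vanishing space of dimension AT MOST `p − 1` for the `A_{p−1}` degeneration `y^p = x₁² + x₂²` (Carlson–Toledo
# 1999 §6; one named fact — `carlsonToledo1999_nodalMeridianLocalMonodromy` WITHOUT the dimension EQUALITY, i.e.
# without the injectivity of the vanishing homology in the nearby fibre)

Family `hodge`, layer `Literature/AlgebraicGeometry/HodgeTheory`. Written by the prover seat `hodge-nonav-prover-Ax`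
(g9, second cut of the day, cell `hodge-nonav`) for crux K1 `VeryGeneralDeckCommutatorsInHg` of the route
`Summits/HodgeConjecture/HodgeConjecture/Theses/CyclicUnitaryPowers.lean` (stmt-HodgeConjecture-19544), whose binder
`stub_ct99NodalMeridianReflection` is the sibling fact `carlsonToledo1999_nodalMeridianMonodromy_isCyclicReflection`
(file `CyclicCoverNodalMeridianMonodromy`, prover-Ax g8).

## Why a fourth, still weaker statement (the localisation principle alone)

This file is the sibling `carlsonToledo1999_nodalMeridianLocalMonodromy` (prover-Ax g9, same day) with its last
clause `dim V = p − 1` weakened to `dim V ≤ p − 1`. A discharge then needs ONLY the localisation principle for the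
pencil `x₃^p = f₁ + c·g` at its `A_{p−1}` point — a linear map `j : H₂(F_loc; ℚ) → H²(X_ε; ℚ)` from the vanishing
homology of the Milnor fibre (`dim = μ = p − 1`, local monodromy `h` with `Σ_{i<p} h^i = 0`: tree files
`Geometry/ComplexAnalytic/PhamBrieskorn*`) with `T ∘ j = j ∘ h_*` and `(T − 1)H² ⊆ im j` (the monodromy is the
identity off the Milnor ball; AGZV II §1.1 `h_* = id + var ∘ i_*`) — and NOT the injectivity of `j` (equivalently the
non-degeneracy of the `A_{p−1}` intersection form and its compatibility with the cup product of `X_ε`), NOR the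
non-vanishing of the vanishing class: the consumer recovers `V ≠ 0` globally (if the nodal meridian acted trivially,
the monodromy group — the normal closure of one meridian — would be trivial, every class invariant, hence fixed by
the covering transformation by the invariant-cycle theorem, so `b₂(X_F) = dim H²(X_F)^σ = 1`, contradicting
`b₂ = p³ − 4p² + 6p − 2`), and `dim V = p − 1` from the recognition theorem's own dimension count
(`CyclicReflectionRecognition`: `(T − 1)H ⊆ V` is a `ℚ(ζ_p)`-line). What follows is the sibling's account, verbatim
where unchanged.

The sibling fact renders CT99 §6 Proposition in full: the monodromy `T` of a meridian centred at a one-nodal branch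
curve is, on the `(p−1)`-dimensional vanishing space `V`, THE COVERING TRANSFORMATION `τ` ("`T = σ₀ ⊗ (−1) ⊗ (−1)`",
`σ₀ = y ↦ ζy` being the restriction of the cyclic automorphism `σ` of the universal family), and the identity on
`V^⊥`. The present fact keeps only the part of that statement which does NOT mention `σ`: the vanishing space `V`
(`dim V = p − 1`: "the space of vanishing cycles `V` for the singularity (kdoublept) is `(k−1)`-dimensional"),
the localisation `(T − 1)H² ⊆ V` ("`T` is given by (TVcxreflectionformula) on `V` and by the identity on `V^⊥`",
`H = V ⊕ V^⊥`), and the order of `T` on `V` ("`T` acts on the `(k−1)`-dimensional space of vanishing cycles as a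
transformation of order `k` […] the eigenvalues are the `k`-th roots of unity `μ ≠ 1`", whence
`1 + T + ⋯ + T^{k−1} = 0` on `V`). This is the local monodromy of the SURFACE singularity `A_{p−1}`,
`y^p = uv`, by itself — Milnor's fibration theorem with the Brieskorn–Pham/Milnor–Orlik description of the
monodromy of `z₀^{a₀} + ⋯ + z_n^{a_n}` (eigenvalues `Π ω_i`, `ω_i^{a_i} = 1`, `ω_i ≠ 1`; here `(−1)(−1)ζ^j = ζ^j`,
`1 ≤ j ≤ p − 1`) and the localisation of the monodromy of a degeneration with one isolated singular point to the
Milnor ball (the monodromy diffeomorphism is the identity off the ball; variation operator) — with no reference to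
the global covering group. The identification "`T|_V` is a power of `τ`" is then a THEOREM of the tree
(`CyclicReflectionRecognition.exists_pow_isCyclicReflection_of_commute`: `T` commutes with `τ` —
`CyclicCoverMonodromyCommutesDeck.ratTransport_comm_deck` — and `dim H²(X_F; ℚ)^τ = 1 < p − 1`), for `p` prime,
which is the generality of the crux (`p` prime, `p ≥ 7`). The sibling `carlsonToledo1999_nodalMeridianLocalMonodromy` implies this one —
PROVED NEXT TO IT below (`carlsonToledo1999_nodalMeridianLocalMonodromyBound_of_localMonodromy`), so this def is a
recorded COROLLARY shape of an already-typed fact, not independent cited content. The hypothesis `Odd p` is NOT used by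
the weakened content (CT99 invokes `k` odd only for the non-degeneracy of the intersection form on `V`, which this fact
omits; `Σ_{i<p} T^i = 0` on `V` and `dim V ≤ μ = p − 1` hold for every `k`); it is kept for uniformity with the sibling.

## Source, verbatim ([CarlsonToledo1999], arXiv text `paper:arxiv-alg-geom_9708002`, §6, p0013–p0014)

* "Thus `T` acts on the `(k−1)`-dimensional space of vanishing cycles as a transformation of order `k`. Over the
  complex numbers it is diagonalizable, and the eigenvalues are the `k`-th roots of unity `μ ≠ 1`." (for `y^k = t`)
* "It follows from our discussion that the space of vanishing cycles `V` for the singularity (kdoublept) is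
  `(k−1)`-dimensional and that the local monodromy transformation is `T = σ₀ ⊗ (−1) ⊗ ⋯ ⊗ (−1)` […] Thus `T` is a
  cyclic transformation of order `k` or `2k`, depending on whether the dimension of the cyclic cover is even or odd.
  In any case, `T` is diagonalizable with eigenvectors `η_i` and eigenvalues `λ_i`, where `λ_i = ± μ_i` with
  `μ_i = ζ^i` […] `i = 1, ⋯, k−1`." (here the cover is a surface: `λ_i = (−1)^{n+1} μ_i = ζ^i`, order `k`)
* "suppose that `k` is odd. Then the intersection form on the space `V` of local vanishing cycles for the
  degeneration (kdoublept) is nondegenerate. Consequently `H^{n+1}(Y_õ)` splits orthogonally as `V ⊕ V^⊥`. The action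
  on `H^{n+1}(Y_õ)` of the monodromy transformation `T` for the meridian corresponding to the degeneration
  (kdoublept) is given by (TVcxreflectionformula) on `V` and by the identity on `V^⊥`."

General theory behind it: [ArnoldGuseinzadeVarchenko2012] Part I §1.1 (monodromy and variation operators,
`h_* = id + var ∘ i_*`; the monodromy transformation is the identity off the Milnor ball, held text p0013, p0025),
§2.3 Thm. 2.2; [Dimca1992] Ch. 3 (1.19) (monodromy of a weighted homogeneous polynomial, `h^N = 1`) and the proof
of Thm. (4.10) (eigenvalues of the monodromy of a Brieskorn–Pham polynomial are the products `t_{a₀}^{j₀} ⋯ t_{a_n}^{j_n}`,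
`1 ≤ j_k ≤ a_k − 1`; held text p0078, p0095–p0096); [Milnor1968] Thm. 9.1.

## Rendering (case `n = 1` of CT99's `ℙⁿ = ℙ²`, `k = d = p` odd, `3 ≤ p`)

The quantifier prefix is that of the sibling fact (base `cyclicCoverBase p`, family `cyclicCoverFamily p`,
irreducible discriminant equation `D`, coefficient chart `χ`, tree-meridian `μ` based at `χ [F]` whose centre is a
one-nodal ternary `p`-form, its loop `γ` read in `S(ℂ)`) WITHOUT the identification `e` and the automorphism `τ`,
which the statement does not mention. Conclusion: the rational transport `T` along `γ` exists, and there is a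
subspace `V ≤ H²(𝒴_{[F]}(ℂ); ℚ)` — the vanishing space — with `T x − x ∈ V` for all `x`, `Σ_{i<p} T^i v = 0` for
`v ∈ V`, and `dim V ≤ p − 1`. (Orientation conventions are irrelevant: `T` and `T⁻¹` satisfy it together.)

## What is NOT here

The identification of `T|_V` with (a power of) the covering transformation and the non-degeneracy of the cup form
on `V` — both THEOREMS of the tree given this fact (`CyclicReflectionRecognition`,
`CyclicReflectionVanishingNondegenerate`); the local analytic theory itself (Milnor fibration of `y^p = uv`, its
monodromy, the localisation to the Milnor ball) — the content of the fact, of which the tree holds the local model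
(`Geometry/ComplexAnalytic/PhamBrieskorn*`: `μ = p − 1`, `Σ_{i<p} σ^i = 0` on `H₂(F)`); the theorem
"smooth point of the discriminant ⇒ one node" — not needed (the centre is ASSUMED one-nodal, as in the sibling).

## References

* [CarlsonToledo1999] J. A. Carlson, D. Toledo, Discriminant complements and kernels of monodromy
  representations, Duke Math. J. 97 (1999) 621–648; arXiv alg-geom/9708002, §6 (kdoublept) and Proposition
  (p0013–p0014), §1 (p0003), §2 (universalcyclic) (p0004–p0005).
* [ArnoldGuseinzadeVarchenko2012] V. I. Arnold, S. M. Gusein-Zade, A. N. Varchenko, Singularities of Differentiable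
  Maps, Volume 2, Birkhäuser (2012 reprint), Part I §1.1, §2.3 Thm. 2.2.
* [Dimca1992] A. Dimca, Singularities and Topology of Hypersurfaces, Springer Universitext (1992), Ch. 3 (1.19),
  Thm. (4.10) and its proof.
* [Milnor1968] J. Milnor, Singular points of complex hypersurfaces, Ann. of Math. Studies 61 (1968), Thm. 9.1.
* [VoisinHodgeII2003] C. Voisin, Hodge Theory and Complex Algebraic Geometry II, CUP 2003, §2.3.1, §3.2.1.
-/

noncomputable section

namespace Literature.AlgebraicGeometry.HodgeTheory

open CategoryTheory
open Literature.AlgebraicTopology.SingularHomology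
open Literature.AlgebraicGeometry.Motives Literature.AlgebraicGeometry.Motives.UniversalHypersurface
open Literature.AlgebraicGeometry.HodgeTheory.UniversalHypersurface
open Literature.AlgebraicGeometry.FundamentalGroup

/-! ### The named fact -/

/-- **Named fact (Carlson–Toledo 1999, §6 at the degeneration (kdoublept), its `σ`-free part, bound form; case
`n = 1`, `k = d = p` odd, `p ≥ 3`): the local monodromy of a meridian of the discriminant of the universal family of
`p`-cyclic covers of the plane CENTRED AT A ONE-NODAL BRANCH CURVE is trivial modulo a vanishing space of dimension
at most `p − 1` on which `1 + T + ⋯ + T^{p−1} = 0`.** For a non-zero ternary `p`-form `f` with smooth cover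
`X_F = V(x₃^p − f)`, an irreducible equation `D` of the discriminant `Δ̃ = {b | x₃^p − f_b singular}`, a coefficient
chart `χ : S(ℂ) ≃ₜ {D ≠ 0}`, a meridian `μ` of `V(D)` based at `χ [F]` whose centre `y` is the coefficient vector
of a ternary `p`-form `f_y = Σ_e y_e x^e` with exactly one singular point, an ordinary double point
(`IsNodalFormWithNodes f_y ![x]`: the cover acquires the singularity `y^p = x₁² + x₂²`), and its loop `γ` read in
`S(ℂ)`: the rational transport `T` of `R² u_* ℚ` along `γ` exists and there is a subspace
`V ≤ H²(𝒴_{[F]}(ℂ); ℚ)` ("the space of vanishing cycles") with `T x − x ∈ V` for every `x` ("`T` is given by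
[…] on `V` and by the identity on `V^⊥`", `H = V ⊕ V^⊥`), `Σ_{i<p} T^i v = 0` for `v ∈ V` ("a transformation of
order `k` […] the eigenvalues are the `k`-th roots of unity `μ ≠ 1`"; for the surface `λ_i = ζ^i`,
`1 ≤ i ≤ k − 1`) and `dim V ≤ p − 1` ("`(k−1)`-dimensional"; only the upper bound is recorded). The part of §6
identifying `T|_V` with the covering transformation `σ₀ = σ|`, the dimension EQUALITY and the non-triviality of `T`
are OMITTED (theorems of the tree for `p` prime given `b₂`: `CyclicReflectionRecognition` and its Summits consumers);
the sibling `carlsonToledo1999_nodalMeridianLocalMonodromy` implies this one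
(`carlsonToledo1999_nodalMeridianLocalMonodromyBound_of_localMonodromy` below); `Odd p` is unused by the weakened
content and kept only for uniformity. `-- TODO(general form): k ∣ d, any n: the local monodromy of y^k = x₁² + ⋯ + x_n² has order k or
2k with eigenvalues (−1)^{n+1}ζ^i on the (k−1)-dimensional vanishing space (CT99 §6; Milnor–Orlik).`
[cite: CarlsonToledo1999, §6 (kdoublept) (held text p0013–p0014), §1 (p0003), §2 (universalcyclic) (p0004–p0005)]
[cite: ArnoldGuseinzadeVarchenko2012, Part I §1.1 (held text p0013, p0025) and §2.3 Thm. 2.2 (p0040)]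
[cite: Dimca1992, Ch. 3 (1.19) (held text p0078) and proof of Thm. (4.10) (p0095–p0096)] -/
def carlsonToledo1999_nodalMeridianLocalMonodromyBound : Prop :=
  ∀ ⦃p : ℕ⦄ [NeZero p], Odd p → 3 ≤ p →
    ∀ (f : MvPolynomial (Fin 3) ℂ), f.IsHomogeneous p → f ≠ 0 →
      IsSmoothProjective 2 (SmoothHypersurface.hypersurface (cyclicCoverForm p f)) →
    ∀ (D : MvPolynomial (TernaryIndex p) ℂ), Irreducible D → IsDiscriminantEquation p D →
    ∀ (χ : ComplexPoints (cyclicCoverBase p) ≃ₜ affineHypersurfaceComplement ![D]), IsCoefficientChart p D χ →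
    ∀ (μ : Meridian ![D] (χ (cyclicCoverPoint p f)) 0),
      (∃ x : Fin 3 → ℂ, IsNodalFormWithNodes (n := 1)
        (∑ e : TernaryIndex p, MvPolynomial.monomial e.1 (μ.y e)) ![x]) →
    ∀ (γ : Path (cyclicCoverPoint p f) (cyclicCoverPoint p f)), (∀ θ, χ (γ θ) = μ.loop θ) →
    ∃ (T : bettiCohomology (fiberOver (cyclicCoverFamily p) (cyclicCoverPoint p f)) 2 ≃ₗ[ℚ]
          bettiCohomology (fiberOver (cyclicCoverFamily p) (cyclicCoverPoint p f)) 2)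
      (V : Submodule ℚ (bettiCohomology (fiberOver (cyclicCoverFamily p) (cyclicCoverPoint p f)) 2)),
      IsRatTransport (cyclicCoverFamily p) 2 (cyclicCoverFamily_locallyTrivial p) (cyclicCoverLoopClass p γ) T ∧
      (∀ x, T x - x ∈ V) ∧
      (∀ v ∈ V, (∑ i ∈ Finset.range p, (T ^ i) v) = 0) ∧
      Module.finrank ℚ V ≤ p - 1

/-! ### The bound form is a corollary of the sibling fact -/

/-- **`carlsonToledo1999_nodalMeridianLocalMonodromy` implies its bound form** (drop the dimension equality
`dim V = p − 1` to `dim V ≤ p − 1`): the new def is dominated by the already-typed sibling, so its ledger debt is that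
of a corollary. [cite: CarlsonToledo1999, §6 (kdoublept) (held text p0013–p0014)] -/
theorem carlsonToledo1999_nodalMeridianLocalMonodromyBound_of_localMonodromy
    (h : carlsonToledo1999_nodalMeridianLocalMonodromy) : carlsonToledo1999_nodalMeridianLocalMonodromyBound := by
  intro p _ hodd h3 f hf hf0 hX D hD hDisc χ hχ μ hnode γ hγ
  obtain ⟨T, V, h1, h2, h3', h4⟩ := h hodd h3 f hf hf0 hX D hD hDisc χ hχ μ hnode γ hγ
  exact ⟨T, V, h1, h2, h3', h4.le⟩

end Literature.AlgebraicGeometry.HodgeTheory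

end
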